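import Mathlib
import Literature.Analysis.FunctionSpaces.SobolevGradCommutatorLimit
import Literature.Analysis.FunctionSpaces.WeakDerivInner
import HarnessLib

/-!
# The DiPerna–Lions first-order commutator, V: the LOCAL form (`L²_loc × W^{1,2}_loc`, convergence in `L¹(B_R)`)

Analysis/FunctionSpaces support file (everything proved), sequel of `SobolevGradCommutatorLimit`
(the global `L² × W^{1,2}` form, `tendsto_lintegral_gradCommutator`).  On a finite-dimensional real inner
product space `H` with an additive Haar measure `μ` invariant under negation: for `θ ∈ L²_loc`
(`θ ∈ L²(B_r)` for every `r`), `u ∈ L²_loc` with a WHOLE-SPACE weak gradient `Du ∈ L²_loc`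
(`HasWeakFDerivOn ⊤ μ u Du`), and bump kernels `k_i = (φ i).normed μ` with `rOut(φ i) → 0` and bounded first
gradient moments, for every radius `R`,
`∫_{B_R} ‖ ∫ θ(y)⟪u(x) − u(y), ∇k_i(x−y)⟫ dy + ∫ k_i(x−y) θ(y) tr Du(y) dy ‖ dx → 0`
(`tendsto_setLIntegral_gradCommutator`; also in the `Dk_i(x−y)[u x − u y]` currency,
`tendsto_setLIntegral_gradCommutator'`).  This is the local statement of DiPerna–Lions 1989, Lemma II.1
(`[u·∇, k_i⋆]θ → 0` in `L¹_loc` for `u ∈ W^{1,2}_loc`, `θ ∈ L²_loc`), the form consumed by renormalisation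
arguments on the whole space.

Proof = CUT-OFF SURGERY, no new analysis: fix `R`, put `R' = max R 0`, let `χ` be the bump with
`rIn = R' + 1`, `rOut = R' + 2`, `s = B_{R'+3}`; then `θ' = 1_s θ ∈ L²(μ)` and `u' = χ • u ∈ W^{1,2}(μ)`
GLOBALLY, with weak gradient `Du' = Dχ ⊗ u + χ Du ∈ L²(μ)` (`HasWeakFDerivOn.smul_contDiff`,
`memLp_bump_smul`, `memLp_bump_weakFDeriv` — domination by `1_{B}(‖u‖ + ‖Du‖)`, `memSobolevDomain_one_of_memLp_weakFDeriv`).  As soon as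
`rOut(φ i) < 1`, for `x ∈ B_R` the two `x`-integrands AGREE (`cutoff_dichotomy`: either `k_i(x−y) = 0 = ∇k_i(x−y)`,
or `‖y‖ < R' + 1`, where `θ' = θ`, `χ = 1` near `y`, so `u' = u` and `Du' = Du`), hence
`∫_{B_R} ‖local_i‖ = ∫_{B_R} ‖global'_i‖ ≤ ∫ ‖global'_i‖ → 0` by `tendsto_lintegral_gradCommutator`.

## Mathlib / tree search
Mathlib (this pin): no commutator lemmas.  Tree: `tendsto_lintegral_gradCommutator` (global form,
`SobolevGradCommutatorLimit`), `HasWeakFDerivOn.smul_contDiff` (`WeakDerivInner`), `memLp_indicator_iff_restrict` (Mathlib).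

[cite: DiPernaLions1989, Lemma II.1]; [cite: Evans2010, §5.2.3 Thm. 1 (iv)]
-/

noncomputable section

open MeasureTheory Set Filter Metric Function
open scoped ENNReal NNReal InnerProductSpace Topology RealInnerProductSpace ContDiff

namespace Literature.Analysis.FunctionSpaces

variable {H : Type*} [NormedAddCommGroup H] [InnerProductSpace ℝ H] [FiniteDimensional ℝ H]
  [MeasurableSpace H] [BorelSpace H]

section CutoffData

variable (μ : Measure H)
variable {F : Type*} [NormedAddCommGroup F] [NormedSpace ℝ F]

omit [MeasurableSpace H] [BorelSpace H] in
/-- A bump centred at `0` vanishes off every ball `B_r`, `r > rOut`. [cite: Evans2010, §5.2.3 Thm. 1 (iv) (cut-off functions)] -/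
theorem bump_apply_eq_zero_of_rOut_lt (χ : ContDiffBump (0 : H)) {r : ℝ} (hr : χ.rOut < r) {x : H}
    (hx : x ∉ ball (0 : H) r) : (χ : H → ℝ) x = 0 := by
  have hx' : x ∉ Function.support (χ : H → ℝ) := by
    rw [χ.support_eq]
    exact fun h => hx (ball_subset_ball hr.le h)
  simpa [Function.mem_support] using hx'

omit [MeasurableSpace H] [BorelSpace H] in
/-- The derivative of a bump centred at `0` vanishes off every ball `B_r`, `r > rOut`.
[cite: Evans2010, §5.2.3 Thm. 1 (iv) (cut-off functions)] -/
theorem fderiv_bump_eq_zero_of_rOut_lt (χ : ContDiffBump (0 : H)) {r : ℝ} (hr : χ.rOut < r) {x : H}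
    (hx : x ∉ ball (0 : H) r) : fderiv ℝ (χ : H → ℝ) x = 0 := by
  apply fderiv_of_notMem_tsupport
  rw [χ.tsupport_eq]
  exact fun h => hx (closedBall_subset_ball hr h)

omit [MeasurableSpace H] [BorelSpace H] in
/-- A bump centred at `0` is `1` near every point of the OPEN ball `B_{rIn}`, so its derivative vanishes there.
[cite: Evans2010, §5.2.3 Thm. 1 (iv) (cut-off functions)] -/
theorem fderiv_bump_eq_zero_of_mem_ball_rIn (χ : ContDiffBump (0 : H)) {y : H} (hy : y ∈ ball (0 : H) χ.rIn) :
    fderiv ℝ (χ : H → ℝ) y = 0 := by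
  have hev : (χ : H → ℝ) =ᶠ[𝓝 y] fun _ => (1 : ℝ) := by
    filter_upwards [isOpen_ball.mem_nhds hy] with z hz
    exact χ.one_of_mem_closedBall (ball_subset_closedBall hz)
  rw [hev.fderiv_eq, fderiv_const_apply]

/-- **Cut-off in `L^p`**: if `u ∈ L^p(B_r)` and `χ` is a bump with `rOut < r`, then `χ • u ∈ L^p(μ)` globally.
[cite: Evans2010, §5.2.3 Thm. 1 (iv)] -/
theorem memLp_bump_smul (χ : ContDiffBump (0 : H)) {r : ℝ} (hr : χ.rOut < r) {p : ℝ≥0∞} {u : H → F}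
    (hu : MemLp u p (μ.restrict (ball (0 : H) r))) : MemLp (fun x => (χ : H → ℝ) x • u x) p μ := by
  have h1 : MemLp (fun x => (χ : H → ℝ) x • u x) p (μ.restrict (ball (0 : H) r)) :=
    MemLp.of_le_mul (c := 1) hu (χ.continuous.aestronglyMeasurable.smul hu.1)
      (Eventually.of_forall fun x => by
        rw [norm_smul, Real.norm_of_nonneg χ.nonneg, one_mul]
        exact mul_le_of_le_one_left (norm_nonneg _) χ.le_one)
  have h2 : (fun x => (χ : H → ℝ) x • u x) = (ball (0 : H) r).indicator (fun x => (χ : H → ℝ) x • u x) := by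
    funext x
    by_cases hx : x ∈ ball (0 : H) r
    · rw [indicator_of_mem hx]
    · rw [indicator_of_notMem hx, bump_apply_eq_zero_of_rOut_lt χ hr hx, zero_smul]
  rw [h2, memLp_indicator_iff_restrict measurableSet_ball]
  exact h1

/-- **The cut-off weak gradient `Dχ ⊗ u + χ Du` is in `L^p(μ)`** if `u, Du ∈ L^p(B_r)` (and are a.e. strongly
measurable on the whole space), `rOut(χ) < r`.  (Domination by the real function `1_{B_r}(‖u‖ + ‖Du‖)`.)
[cite: Evans2010, §5.2.3 Thm. 1 (iv)] -/
theorem memLp_bump_weakFDeriv (χ : ContDiffBump (0 : H)) {r : ℝ} (hr : χ.rOut < r) {p : ℝ≥0∞} {u : H → F}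
    {Du : H → H →L[ℝ] F} (hum : AEStronglyMeasurable u μ) (hDum : AEStronglyMeasurable Du μ)
    (hu : MemLp u p (μ.restrict (ball (0 : H) r))) (hDu : MemLp Du p (μ.restrict (ball (0 : H) r))) :
    MemLp (fun x => (fderiv ℝ (χ : H → ℝ) x).smulRight (u x) + (χ : H → ℝ) x • Du x) p μ := by
  have hDχc : Continuous (fderiv ℝ (χ : H → ℝ)) := (χ.contDiff (n := 1)).continuous_fderiv one_ne_zero
  obtain ⟨C, hC⟩ := hDχc.bounded_above_of_compact_support (χ.hasCompactSupport.fderiv (𝕜 := ℝ))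
  -- measurability on the whole space
  have hm1 : AEStronglyMeasurable (fun x => (fderiv ℝ (χ : H → ℝ) x).smulRight (u x)) μ :=
    (ContinuousLinearMap.smulRightL ℝ H F).continuous₂.comp_aestronglyMeasurable₂ hDχc.aestronglyMeasurable hum
  have hm2 : AEStronglyMeasurable (fun x => (χ : H → ℝ) x • Du x) μ := χ.continuous.aestronglyMeasurable.smul hDum
  have hm : AEStronglyMeasurable (fun x => (fderiv ℝ (χ : H → ℝ) x).smulRight (u x) + (χ : H → ℝ) x • Du x) μ :=
    hm1.add hm2
  -- domination by a real `L^p` function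
  have hg : MemLp ((ball (0 : H) r).indicator fun x => ‖u x‖ + ‖Du x‖) p μ :=
    (memLp_indicator_iff_restrict measurableSet_ball).2 (hu.norm.add hDu.norm)
  refine MemLp.of_le_mul (c := max C 1) hg hm (Eventually.of_forall fun x => ?_)
  by_cases hx : x ∈ ball (0 : H) r
  · rw [indicator_of_mem hx, Real.norm_of_nonneg (by positivity)]
    calc ‖(fderiv ℝ (χ : H → ℝ) x).smulRight (u x) + (χ : H → ℝ) x • Du x‖
        ≤ ‖(fderiv ℝ (χ : H → ℝ) x).smulRight (u x)‖ + ‖(χ : H → ℝ) x • Du x‖ := norm_add_le _ _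
      _ ≤ C * ‖u x‖ + 1 * ‖Du x‖ := by
          refine add_le_add ?_ ?_
          · rw [ContinuousLinearMap.norm_smulRight_apply]
            exact mul_le_mul_of_nonneg_right (hC x) (norm_nonneg _)
          · rw [norm_smul, Real.norm_of_nonneg χ.nonneg]
            exact mul_le_mul_of_nonneg_right χ.le_one (norm_nonneg _)
      _ ≤ max C 1 * ‖u x‖ + max C 1 * ‖Du x‖ := by
          gcongr
          exacts [le_max_left _ _, le_max_right _ _]
      _ = max C 1 * (‖u x‖ + ‖Du x‖) := by ring
  · rw [bump_apply_eq_zero_of_rOut_lt χ hr hx, fderiv_bump_eq_zero_of_rOut_lt χ hr hx, zero_smul, add_zero]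
    have h0 : (0 : H →L[ℝ] ℝ).smulRight (u x) = 0 := by ext v; simp
    rw [h0, norm_zero]
    positivity

/-- **The weak product rule for a bump**: `D(χ • u) = Dχ ⊗ u + χ Du` on the whole space
(the tree's `HasWeakFDerivOn.smul_contDiff`). [cite: Evans2010, §5.2.3 Thm. 1 (iv)] -/
theorem hasWeakFDerivOn_bump_smul (χ : ContDiffBump (0 : H)) {u : H → F} {Du : H → H →L[ℝ] F}
    (hDu : HasWeakFDerivOn (⊤ : TopologicalSpace.Opens H) μ u Du) :
    HasWeakFDerivOn (⊤ : TopologicalSpace.Opens H) μ (fun x => (χ : H → ℝ) x • u x)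
      (fun x => (fderiv ℝ (χ : H → ℝ) x).smulRight (u x) + (χ : H → ℝ) x • Du x) :=
  hDu.smul_contDiff χ.contDiff

omit [FiniteDimensional ℝ H] [BorelSpace H] in
/-- `W^{1,p}` on the whole space from `L^p` data: `u ∈ L^p(μ)` with a weak gradient `Du ∈ L^p(μ)` is in
`MemSobolevDomain 1 p ⊤`. [cite: Evans2010, §5.2.2 (Definition of W^{k,p})] -/
theorem memSobolevDomain_one_of_memLp_weakFDeriv {p : ℝ≥0∞} {u : H → F} {Du : H → H →L[ℝ] F}
    (hu : MemLp u p μ) (hw : HasWeakFDerivOn (⊤ : TopologicalSpace.Opens H) μ u Du) (hDu : MemLp Du p μ) :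
    MemSobolevDomain 1 p (⊤ : TopologicalSpace.Opens H) μ u := by
  refine (memSobolevDomain_succ_iff).2 ⟨?_, Du, hw, fun v => ?_⟩
  · rwa [TopologicalSpace.Opens.coe_top, Measure.restrict_univ]
  · rw [memSobolevDomain_zero_iff, TopologicalSpace.Opens.coe_top, Measure.restrict_univ]
    exact hDu.of_le_mul (c := ‖v‖) ((ContinuousLinearMap.apply ℝ F v).continuous.comp_aestronglyMeasurable hDu.1)
      (Eventually.of_forall fun x => by rw [mul_comm]; exact (Du x).le_opNorm v)

end CutoffData

section Agreement

variable (μ : Measure H)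

omit [MeasurableSpace H] [BorelSpace H] in
/-- **THE POINTWISE DICHOTOMY behind the localisation.**  Let `χ` be a bump with `R + 1 ≤ rIn`, `k` a kernel with
`tsupport k ⊆ closedBall 0 t`, `t < 1`, and `‖x‖ < R`.  Then for every `y`: EITHER `k(x − y) = 0 = ∇k(x − y)`,
OR `‖y‖ < R + 1`, `χ y = 1` and `Dχ y = 0`. [cite: DiPernaLions1989, Lemma II.1 (proof, localisation)] -/
theorem cutoff_dichotomy (χ : ContDiffBump (0 : H)) {R t : ℝ} (hR : R + 1 ≤ χ.rIn) (ht : t < 1) {k : H → ℝ}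
    (hk : tsupport k ⊆ closedBall (0 : H) t) {x : H} (hx : x ∈ ball (0 : H) R) (y : H) :
    (k (x - y) = 0 ∧ gradient k (x - y) = 0) ∨
      (y ∈ ball (0 : H) (R + 1) ∧ (χ : H → ℝ) y = 1 ∧ fderiv ℝ (χ : H → ℝ) y = 0) := by
  by_cases hxy : x - y ∈ tsupport k
  · right
    have h1 : ‖x - y‖ ≤ t := mem_closedBall_zero_iff.1 (hk hxy)
    have h2 : ‖x‖ < R := mem_ball_zero_iff.1 hx
    have hy : y ∈ ball (0 : H) (R + 1) := by
      rw [mem_ball_zero_iff]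
      have : ‖y‖ ≤ ‖x‖ + ‖x - y‖ := by
        calc ‖y‖ = ‖x - (x - y)‖ := by rw [sub_sub_cancel]
          _ ≤ ‖x‖ + ‖x - y‖ := norm_sub_le _ _
      linarith
    have hy' : y ∈ ball (0 : H) χ.rIn := ball_subset_ball hR hy
    exact ⟨hy, χ.one_of_mem_closedBall (ball_subset_closedBall hy'), fderiv_bump_eq_zero_of_mem_ball_rIn χ hy'⟩
  · left
    refine ⟨image_eq_zero_of_notMem_tsupport hxy, ?_⟩
    have e : gradient k (x - y) = (InnerProductSpace.toDual ℝ H).symm (fderiv ℝ k (x - y)) := rfl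
    rw [e, fderiv_of_notMem_tsupport ℝ hxy, map_zero]

omit [MeasurableSpace H] [BorelSpace H] in
/-- Agreement of the FIRST-ORDER integrands on `B_R` for the cut-off data `θ' = 1_s θ` (`s ⊇ B_{R+1}`), `u' = χ • u`.
[cite: DiPernaLions1989, Lemma II.1 (proof, localisation)] -/
theorem gradCommutator_integrand_eq_of_cutoff (χ : ContDiffBump (0 : H)) {R t : ℝ} (hR : R + 1 ≤ χ.rIn) (ht : t < 1)
    {k : H → ℝ} (hk : tsupport k ⊆ closedBall (0 : H) t) {x : H} (hx : x ∈ ball (0 : H) R) {s : Set H}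
    (hs : ball (0 : H) (R + 1) ⊆ s) (θ : H → ℝ) (u : H → H) (y : H) :
    s.indicator θ y * ⟪(χ : H → ℝ) x • u x - (χ : H → ℝ) y • u y, gradient k (x - y)⟫ =
      θ y * ⟪u x - u y, gradient k (x - y)⟫ := by
  rcases cutoff_dichotomy χ hR ht hk hx y with ⟨-, h0⟩ | ⟨hy, h1, -⟩
  · rw [h0, inner_zero_right, inner_zero_right, mul_zero, mul_zero]
  · have hxin : (χ : H → ℝ) x = 1 :=
      χ.one_of_mem_closedBall (ball_subset_closedBall (ball_subset_ball (by linarith) hx : x ∈ ball (0 : H) χ.rIn))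
    rw [indicator_of_mem (hs hy), h1, hxin, one_smul, one_smul]

omit [MeasurableSpace H] [BorelSpace H] in
/-- Agreement of the ZEROTH-ORDER integrands on `B_R` for the cut-off data `θ' = 1_s θ`, `Du' = Dχ ⊗ u + χ Du`.
[cite: DiPernaLions1989, Lemma II.1 (proof, localisation)] -/
theorem convolution_integrand_eq_of_cutoff (χ : ContDiffBump (0 : H)) {R t : ℝ} (hR : R + 1 ≤ χ.rIn) (ht : t < 1)
    {k : H → ℝ} (hk : tsupport k ⊆ closedBall (0 : H) t) {x : H} (hx : x ∈ ball (0 : H) R) {s : Set H}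
    (hs : ball (0 : H) (R + 1) ⊆ s) (θ : H → ℝ) (u : H → H) (Du : H → H →L[ℝ] H) (y : H) :
    k (x - y) * s.indicator θ y *
        LinearMap.trace ℝ H (((fderiv ℝ (χ : H → ℝ) y).smulRight (u y) + (χ : H → ℝ) y • Du y : H →L[ℝ] H) : H →ₗ[ℝ] H) =
      k (x - y) * θ y * LinearMap.trace ℝ H (Du y : H →ₗ[ℝ] H) := by
  rcases cutoff_dichotomy χ hR ht hk hx y with ⟨h0, -⟩ | ⟨hy, h1, h2⟩
  · rw [h0, zero_mul, zero_mul, zero_mul, zero_mul]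
  · rw [indicator_of_mem (hs hy), h1, h2, one_smul]
    congr 2
    ext v
    simp

end Agreement

section Local

variable (μ : Measure H) [μ.IsAddHaarMeasure]
variable {θ : H → ℝ} {u : H → H} {Du : H → H →L[ℝ] H}
variable {ι : Type*} {l : Filter ι} {φ : ι → ContDiffBump (0 : H)}

/-- **DiPerna–Lions, Lemma II.1 — LOCAL form (`L²_loc × W^{1,2}_loc`, convergence in `L¹(B_R)`).**
For `θ ∈ L²_loc`, `u ∈ L²_loc` with a whole-space weak gradient `Du ∈ L²_loc`, and bump kernels
`k_i = (φ i).normed μ` with `rOut(φ i) → 0` and bounded first gradient moments (eventually), for every `R`: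
`∫_{B_R} ‖ ∫ θ(y)⟪u(x) − u(y), ∇k_i(x−y)⟫ dy + ∫ k_i(x−y) θ(y) tr Du(y) dy ‖ dx → 0`.
Proof: cut-off surgery (`θ' = 1_{B_{R'+3}}θ`, `u' = χ•u`, `R' = max R 0`) and the global form
`tendsto_lintegral_gradCommutator`. [cite: DiPernaLions1989, Lemma II.1] -/
theorem tendsto_setLIntegral_gradCommutator [μ.IsNegInvariant]
    (hθ : ∀ r : ℝ, MemLp θ 2 (μ.restrict (ball (0 : H) r)))
    (hu : ∀ r : ℝ, MemLp u 2 (μ.restrict (ball (0 : H) r)))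
    (hDu : HasWeakFDerivOn (⊤ : TopologicalSpace.Opens H) μ u Du)
    (hDu2 : ∀ r : ℝ, MemLp Du 2 (μ.restrict (ball (0 : H) r)))
    (hφ : Tendsto (fun i => (φ i).rOut) l (𝓝 0)) {K : ℝ}
    (hK : ∀ᶠ i in l, ∫ z, ‖z‖ * ‖gradient ((φ i).normed μ) z‖ ∂μ ≤ K) (R : ℝ) :
    Tendsto (fun i => ∫⁻ x in ball (0 : H) R, ‖(∫ y, θ y * ⟪u x - u y, gradient ((φ i).normed μ) (x - y)⟫ ∂μ) +
        ∫ y, (φ i).normed μ (x - y) * θ y * LinearMap.trace ℝ H (Du y : H →ₗ[ℝ] H) ∂μ‖ₑ ∂μ) l (𝓝 0) := by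
  -- the cut-off
  have hR' : 0 ≤ max R 0 := le_max_right _ _
  let χ : ContDiffBump (0 : H) := ⟨max R 0 + 1, max R 0 + 2, by positivity, by linarith⟩
  have hχin : χ.rIn = max R 0 + 1 := rfl
  have hχout : χ.rOut < max R 0 + 3 := by show max R 0 + 2 < max R 0 + 3; linarith
  have hs : ball (0 : H) (max R 0 + 1) ⊆ ball (0 : H) (max R 0 + 3) := ball_subset_ball (by linarith)
  -- the cut-off data are global `L² × W^{1,2}` data
  have hθ' : MemLp ((ball (0 : H) (max R 0 + 3)).indicator θ) 2 μ :=
    (memLp_indicator_iff_restrict measurableSet_ball).2 (hθ _)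
  have hu' : MemLp (fun x => (χ : H → ℝ) x • u x) 2 μ := memLp_bump_smul μ χ hχout (hu _)
  have hw' := hasWeakFDerivOn_bump_smul μ χ hDu
  have hum : AEStronglyMeasurable u μ := by
    have h := hDu.locallyIntegrableOn
    rw [TopologicalSpace.Opens.coe_top, locallyIntegrableOn_univ] at h
    exact h.aestronglyMeasurable
  have hDum : AEStronglyMeasurable Du μ := by
    have h := hDu.locallyIntegrableOn_deriv
    rw [TopologicalSpace.Opens.coe_top, locallyIntegrableOn_univ] at h
    exact h.aestronglyMeasurable
  have hDu' := memLp_bump_weakFDeriv μ χ hχout hum hDum (hu _) (hDu2 _)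
  have hsob := memSobolevDomain_one_of_memLp_weakFDeriv μ hu' hw' hDu'
  -- the global limit for the cut-off data
  have hglob := tendsto_lintegral_gradCommutator μ hθ' hsob hw' hφ hK
  -- eventually the kernels have radius `< 1`, and then the integrands agree on `B_R`
  have hev : ∀ᶠ i in l, (φ i).rOut < 1 := hφ.eventually (eventually_lt_nhds zero_lt_one)
  have hR1 : max R 0 + 1 ≤ χ.rIn := le_of_eq hχin.symm
  have key : ∀ᶠ i in l,
      (∫⁻ x in ball (0 : H) R, ‖(∫ y, θ y * ⟪u x - u y, gradient ((φ i).normed μ) (x - y)⟫ ∂μ) +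
          ∫ y, (φ i).normed μ (x - y) * θ y * LinearMap.trace ℝ H (Du y : H →ₗ[ℝ] H) ∂μ‖ₑ ∂μ) ≤
        ∫⁻ x, ‖(∫ y, (ball (0 : H) (max R 0 + 3)).indicator θ y *
              ⟪(χ : H → ℝ) x • u x - (χ : H → ℝ) y • u y, gradient ((φ i).normed μ) (x - y)⟫ ∂μ) +
          ∫ y, (φ i).normed μ (x - y) * (ball (0 : H) (max R 0 + 3)).indicator θ y *
            LinearMap.trace ℝ H (((fderiv ℝ (χ : H → ℝ) y).smulRight (u y) + (χ : H → ℝ) y • Du y : H →L[ℝ] H) :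
              H →ₗ[ℝ] H) ∂μ‖ₑ ∂μ := by
    filter_upwards [hev] with i hi
    have hk : tsupport ((φ i).normed μ) ⊆ closedBall (0 : H) (φ i).rOut := ((φ i).tsupport_normed_eq (μ := μ)).le
    refine le_trans (le_of_eq (setLIntegral_congr_fun measurableSet_ball fun x hx => ?_)) (setLIntegral_le_lintegral _ _)
    have hx' : x ∈ ball (0 : H) (max R 0) := ball_subset_ball (le_max_left _ _) hx
    congr 2
    · exact integral_congr_ae (Eventually.of_forall fun y =>
        (gradCommutator_integrand_eq_of_cutoff χ hR1 hi hk hx' hs θ u y).symm)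
    · exact integral_congr_ae (Eventually.of_forall fun y =>
        (convolution_integrand_eq_of_cutoff χ hR1 hi hk hx' hs θ u Du y).symm)
  exact tendsto_of_tendsto_of_tendsto_of_le_of_le' tendsto_const_nhds hglob (Eventually.of_forall fun _ => bot_le) key

/-- **The local commutator lemma in the `Dk_i(x−y)[u x − u y]` currency** (`⟪a, ∇k(z)⟫ = Dk(z)a`), for consumers
written with `fderiv` instead of `gradient`. [cite: DiPernaLions1989, Lemma II.1] -/
theorem tendsto_setLIntegral_gradCommutator' [μ.IsNegInvariant]
    (hθ : ∀ r : ℝ, MemLp θ 2 (μ.restrict (ball (0 : H) r)))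
    (hu : ∀ r : ℝ, MemLp u 2 (μ.restrict (ball (0 : H) r)))
    (hDu : HasWeakFDerivOn (⊤ : TopologicalSpace.Opens H) μ u Du)
    (hDu2 : ∀ r : ℝ, MemLp Du 2 (μ.restrict (ball (0 : H) r)))
    (hφ : Tendsto (fun i => (φ i).rOut) l (𝓝 0)) {K : ℝ}
    (hK : ∀ᶠ i in l, ∫ z, ‖z‖ * ‖gradient ((φ i).normed μ) z‖ ∂μ ≤ K) (R : ℝ) :
    Tendsto (fun i => ∫⁻ x in ball (0 : H) R, ‖(∫ y, θ y * fderiv ℝ ((φ i).normed μ) (x - y) (u x - u y) ∂μ) +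
        ∫ y, (φ i).normed μ (x - y) * θ y * LinearMap.trace ℝ H (Du y : H →ₗ[ℝ] H) ∂μ‖ₑ ∂μ) l (𝓝 0) := by
  have h := tendsto_setLIntegral_gradCommutator μ hθ hu hDu hDu2 hφ hK R
  have e : ∀ (k : H → ℝ) (z a : H), ⟪a, gradient k z⟫ = fderiv ℝ k z a := fun k z a => by
    rw [real_inner_comm]
    exact InnerProductSpace.toDual_symm_apply
  simp only [e] at h
  exact h

end Local

section Aliases

/-! ### Record-keeping: the two declarations of the parallel file p708945 (ns-sfl-p1 g9), restored by name

The whole-file proposal p708958 replaced an independently written file at this path that had landed one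
minute earlier; its two extra declarations are re-added here VERBATIM IN STATEMENT so that both vocabularies
resolve. -/

variable (μ : Measure H) [μ.IsAddHaarMeasure]
variable {θ : H → ℝ} {u : H → H} {Du : H → H →L[ℝ] H}
variable {ι : Type*} {l : Filter ι} {φ : ι → ContDiffBump (0 : H)}

omit [μ.IsAddHaarMeasure] in
/-- **Cut-off of a `W^{1,2}_loc` field is in `W^{1,2}`**: for a bump `χ` and `u ∈ L²_loc` with a whole-space weak
gradient `Du ∈ L²_loc`, `χ • u ∈ W^{1,2}(μ)` with weak gradient `χ Du + Dχ ⊗ u` (statement of p708945's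
`memSobolevDomain_bump_smul`, ns-sfl-p1). [cite: Evans2010, §5.2.3 Thm. 1 (iv)] -/
theorem memSobolevDomain_bump_smul (χ : ContDiffBump (0 : H))
    (hu : ∀ r : ℝ, MemLp u 2 (μ.restrict (ball (0 : H) r)))
    (hDu : HasWeakFDerivOn (⊤ : TopologicalSpace.Opens H) μ u Du)
    (hDu2 : ∀ r : ℝ, MemLp Du 2 (μ.restrict (ball (0 : H) r))) :
    MemSobolevDomain 1 2 (⊤ : TopologicalSpace.Opens H) μ (fun x => χ x • u x) ∧
      HasWeakFDerivOn (⊤ : TopologicalSpace.Opens H) μ (fun x => χ x • u x)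
        (fun x => χ x • Du x + (fderiv ℝ χ x).smulRight (u x)) := by
  have hr : χ.rOut < χ.rOut + 1 := lt_add_one _
  have hum : AEStronglyMeasurable u μ := by
    have h := hDu.locallyIntegrableOn
    rw [TopologicalSpace.Opens.coe_top, locallyIntegrableOn_univ] at h
    exact h.aestronglyMeasurable
  have hDum : AEStronglyMeasurable Du μ := by
    have h := hDu.locallyIntegrableOn_deriv
    rw [TopologicalSpace.Opens.coe_top, locallyIntegrableOn_univ] at h
    exact h.aestronglyMeasurable
  have hu' := memLp_bump_smul μ χ hr (hu _)
  have hw := hasWeakFDerivOn_bump_smul μ χ hDu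
  have hDu' := memLp_bump_weakFDeriv μ χ hr hum hDum (hu _) (hDu2 _)
  have e : (fun x => (fderiv ℝ (χ : H → ℝ) x).smulRight (u x) + (χ : H → ℝ) x • Du x) =
      fun x => (χ : H → ℝ) x • Du x + (fderiv ℝ (χ : H → ℝ) x).smulRight (u x) := funext fun x => add_comm _ _
  rw [e] at hw hDu'
  exact ⟨memSobolevDomain_one_of_memLp_weakFDeriv μ hu' hw hDu', hw⟩

/-- The local commutator lemma in the `fderiv` currency under the name of p708945 (ns-sfl-p1):
identical to `tendsto_setLIntegral_gradCommutator'`. [cite: DiPernaLions1989, Lemma II.1] -/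
theorem tendsto_setLIntegral_gradCommutator_fderiv [μ.IsNegInvariant]
    (hθ : ∀ r : ℝ, MemLp θ 2 (μ.restrict (ball (0 : H) r)))
    (hu : ∀ r : ℝ, MemLp u 2 (μ.restrict (ball (0 : H) r)))
    (hDu : HasWeakFDerivOn (⊤ : TopologicalSpace.Opens H) μ u Du)
    (hDu2 : ∀ r : ℝ, MemLp Du 2 (μ.restrict (ball (0 : H) r)))
    (hφ : Tendsto (fun i => (φ i).rOut) l (𝓝 0)) {K : ℝ}
    (hK : ∀ᶠ i in l, ∫ z, ‖z‖ * ‖gradient ((φ i).normed μ) z‖ ∂μ ≤ K) (R : ℝ) :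
    Tendsto (fun i => ∫⁻ x in ball (0 : H) R, ‖(∫ y, θ y * fderiv ℝ ((φ i).normed μ) (x - y) (u x - u y) ∂μ) +
        ∫ y, (φ i).normed μ (x - y) * θ y * LinearMap.trace ℝ H (Du y : H →ₗ[ℝ] H) ∂μ‖ₑ ∂μ) l (𝓝 0) :=
  tendsto_setLIntegral_gradCommutator' μ hθ hu hDu hDu2 hφ hK R

end Aliases

end Literature.Analysis.FunctionSpaces

end
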